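import Summits.QuantumFields.YangMills.Theorems.F4SubCurvatureDoorSubCurvatureKernelL1Extension
import Summits.QuantumFields.YangMills.Theorems.LangevinControlUVOSLegsAtWeakCouplingCDefs
import Literature.MeasureTheory.Function.L1BoundedFunctionalDensity
import HarnessLib

/-!
# Route `F4SubCurvatureDoor`, crux `SubCurvatureKernel` ⟨stmt-QuantumFields-23036⟩ — the TWO-POINT DENSITY of an `L¹`-bounded two-point
# functional (kernel extraction, step K1′+K3′)

Helper file (`--supports stmt-QuantumFields-23036 --as helper`; free-hands seat `ym-line-frs-p2` g17, clause (K) of the soft-half scope, HOME INBOX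
2026-08-29T16:34:27Z / 16:47:40Z).  Definition-free, KERNEL-GENERIC (no lattice input), 0 sorry, standard axioms.  No item is closed; no summit, no
crux and no mass gap is proved by this file.

WHAT.  `exists_twoPointDensity`: a continuous linear functional `S₂` on `𝓢((ℝ⁴)², ℂ)` obeying the DENSITY BOUND of an off-diagonal limit point
at separation `δ` (`‖S₂ F‖ ≤ B ∫ ‖F‖` for compactly supported `F` supported in `Separated 2 δ`) is, on compactly supported test functions supported
in `Separated 2 (2δ)`, integration against a bounded measurable two-point density `W` (`‖W‖ ≤ 2B`): `S₂ F = ∫ W(x) F(x) dx`.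
Proof: cut off smoothly at `δ ≤ ‖x₀ − x₁‖ ≤ 2δ` (a `ContDiffBump` in the difference variable) and weight by the smooth, positive, integrable
`ρ(x) = (1 + ‖x₀‖²)⁻³ (1 + ‖x₁‖²)⁻³`; the real and imaginary parts of `g ↦ S₂(η ρ g)` are then bounded by `B ‖g‖_{L¹(ρ dx)}` for the FINITE,
fully supported measure `ρ dx`, so they extend to `L¹(ρ dx)` (✓`exists_extend_L1`, K2′) and have bounded densities there (LEAD sfw-p2 g76's
✓`Literature.MeasureTheory.Function.exists_bounded_density_of_l1_bounded`, K-core, Rudin 6.16); undoing the weight gives the Lebesgue density.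

HONEST LABEL: one piece of clause (K) of the SOFT half of ⟨23036⟩ (the kernel `K(x₀ − x₁)` follows with ✓p733041 translation invariance and
✓p734117 fibre averaging in the sibling file); (C) continuity and the SUB-CURVATURE clause (asymptotic freedom) remain OPEN; ⟨23036⟩ is an open
problem; the Yang–Mills mass gap is NOT proved; no summit is proved by a line.
-/

set_option autoImplicit false

noncomputable section

open scoped SchwartzMap BigOperators ContDiff ENNReal NNReal
open MeasureTheory Filter Topology Set
open Summit.QuantumFields.YangMills.Cruxes.OSLegsAtWeakCouplingC.Sketch (Separated)
open Summit.QuantumFields.YangMills.Theorems.F4SubCurvatureDoorSubCurvatureKernelL1 (exists_extend_L1)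
open Literature.MeasureTheory.Function (exists_bounded_density_of_l1_bounded)

namespace Summit.QuantumFields.YangMills.Theorems.F4SubCurvatureDoorSubCurvatureKernelDensity

/-! ## The weight `ρ` -/

/-- The one-variable weight `(1 + ‖y‖²)⁻³` is integrable on `ℝ⁴` (Japanese bracket, `6 > 4`). -/
theorem integrable_weight₁ :
    Integrable (fun y : EuclideanSpace ℝ (Fin 4) => ((1 + ‖y‖ ^ 2) ^ 3)⁻¹) := by
  have h4 : (Module.finrank ℝ (EuclideanSpace ℝ (Fin 4)) : ℝ) < 6 := by
    rw [finrank_euclideanSpace, Fintype.card_fin]; norm_num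
  refine (integrable_rpow_neg_one_add_norm_sq (μ := volume) h4).congr (Eventually.of_forall fun y => ?_)
  have hpos : 0 < 1 + ‖y‖ ^ 2 := by positivity
  beta_reduce
  rw [show (-6 : ℝ) / 2 = -(3 : ℕ) by norm_num, Real.rpow_neg hpos.le, Real.rpow_natCast]

/-- The one-variable weight is smooth. -/
theorem contDiff_weight₁ : ContDiff ℝ ∞ fun y : EuclideanSpace ℝ (Fin 4) => ((1 + ‖y‖ ^ 2) ^ 3)⁻¹ := by
  refine ContDiff.inv ((contDiff_const.add (contDiff_norm_sq ℝ)).pow 3) fun y => ?_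
  positivity

/-- **The two-point weight** `ρ(x) = (1 + ‖x₀‖²)⁻³ (1 + ‖x₁‖²)⁻³`: positive, at most `1`, smooth, integrable. -/
theorem weight_props :
    let ρ : (Fin 2 → EuclideanSpace ℝ (Fin 4)) → ℝ := fun x => ((1 + ‖x 0‖ ^ 2) ^ 3)⁻¹ * ((1 + ‖x 1‖ ^ 2) ^ 3)⁻¹
    (∀ x, 0 < ρ x) ∧ (∀ x, ρ x ≤ 1) ∧ ContDiff ℝ ∞ ρ ∧ Integrable ρ := by
  intro ρ
  have hge : ∀ y : EuclideanSpace ℝ (Fin 4), 1 ≤ (1 + ‖y‖ ^ 2) ^ 3 := fun y =>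
    one_le_pow₀ (by nlinarith [norm_nonneg y])
  refine ⟨fun x => by positivity, fun x => ?_, ?_, ?_⟩
  · have h0 := inv_le_one_of_one_le₀ (hge (x 0))
    have h1 := inv_le_one_of_one_le₀ (hge (x 1))
    have h0' : 0 ≤ ((1 + ‖x 0‖ ^ 2) ^ 3)⁻¹ := by positivity
    calc ρ x ≤ 1 * 1 := mul_le_mul h0 h1 (by positivity) zero_le_one
      _ = 1 := one_mul 1
  · exact (contDiff_weight₁.comp (contDiff_apply ℝ (EuclideanSpace ℝ (Fin 4)) 0)).mul
      (contDiff_weight₁.comp (contDiff_apply ℝ (EuclideanSpace ℝ (Fin 4)) 1))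
  · have h := Integrable.fintype_prod (ι := Fin 2) (μ := fun _ => (volume : Measure (EuclideanSpace ℝ (Fin 4))))
      (f := fun _ y => ((1 + ‖y‖ ^ 2) ^ 3)⁻¹) fun _ => integrable_weight₁
    refine (h.congr (Eventually.of_forall fun x => ?_) : Integrable _ (Measure.pi fun _ => volume))
    simp only [Fin.prod_univ_two, ρ]

/-! ## The cutoff `η` in the difference variable -/

/-- Points with `δ ≤ ‖x₀ − x₁‖` are `δ`-separated two-point configurations. -/
theorem mem_separated_of_le {δ : ℝ} {x : Fin 2 → EuclideanSpace ℝ (Fin 4)} (h : δ ≤ ‖x 0 - x 1‖) :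
    x ∈ Separated 2 δ := by
  intro i j hij
  fin_cases i <;> fin_cases j
  · exact absurd rfl hij
  · rwa [dist_eq_norm]
  · rw [dist_comm, dist_eq_norm]; exact h
  · exact absurd rfl hij

/-- `2δ`-separated two-point configurations have `2δ ≤ ‖x₀ − x₁‖`. -/
theorem le_norm_sub_of_mem_separated {δ : ℝ} {x : Fin 2 → EuclideanSpace ℝ (Fin 4)} (h : x ∈ Separated 2 δ) :
    δ ≤ ‖x 0 - x 1‖ := by
  have := h 0 1 (by decide)
  rwa [dist_eq_norm] at this

/-! ## ★ The two-point density -/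

/-- ★ **TWO-POINT DENSITY of an `L¹`-bounded two-point functional.**  Let `S₂` be a continuous linear functional on `𝓢((ℝ⁴)², ℂ)` with the
density bound `‖S₂ F‖ ≤ B ∫ ‖F‖` for compactly supported `F` supported in `Separated 2 δ` (`δ > 0`).  Then there is a measurable
`W : (ℝ⁴)² → ℂ` with `‖W‖ ≤ 2B` such that `S₂ F = ∫ W F` for every compactly supported `F` supported in `Separated 2 (2δ)`.
[cite: Rudin1987, Thm. 6.16] [folklore] -/
theorem exists_twoPointDensity (S₂ : 𝓢((Fin 2 → EuclideanSpace ℝ (Fin 4)), ℂ) →L[ℂ] ℂ) {δ B : ℝ} (hδ : 0 < δ) (hB : 0 ≤ B)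
    (hdens : ∀ F : 𝓢((Fin 2 → EuclideanSpace ℝ (Fin 4)), ℂ), HasCompactSupport (F : _ → ℂ) →
      tsupport (F : _ → ℂ) ⊆ Separated 2 δ → ‖S₂ F‖ ≤ B * ∫ x, ‖F x‖) :
    ∃ W : (Fin 2 → EuclideanSpace ℝ (Fin 4)) → ℂ, Measurable W ∧ (∀ x, ‖W x‖ ≤ 2 * B) ∧
      ∀ F : 𝓢((Fin 2 → EuclideanSpace ℝ (Fin 4)), ℂ), HasCompactSupport (F : _ → ℂ) →
        tsupport (F : _ → ℂ) ⊆ Separated 2 (2 * δ) →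
          Integrable (fun x => W x * F x) ∧ S₂ F = ∫ x, W x * F x := by
  classical
  -- the weight and the weighted (finite, fully supported) measure
  set ρ : (Fin 2 → EuclideanSpace ℝ (Fin 4)) → ℝ := fun x => ((1 + ‖x 0‖ ^ 2) ^ 3)⁻¹ * ((1 + ‖x 1‖ ^ 2) ^ 3)⁻¹ with hρ
  obtain ⟨hρpos, hρle, hρs, hρi⟩ : (∀ x, 0 < ρ x) ∧ (∀ x, ρ x ≤ 1) ∧ ContDiff ℝ ∞ ρ ∧ Integrable ρ := weight_props
  have hρm : Measurable ρ := hρs.continuous.measurable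
  set μρ : Measure (Fin 2 → EuclideanSpace ℝ (Fin 4)) := volume.withDensity fun x => ENNReal.ofReal (ρ x) with hμρ
  haveI : IsFiniteMeasure μρ := isFiniteMeasure_withDensity_ofReal hρi.hasFiniteIntegral
  have hac : (volume : Measure (Fin 2 → EuclideanSpace ℝ (Fin 4))) ≪ μρ :=
    withDensity_absolutelyContinuous' (hρm.ennreal_ofReal.aemeasurable)
      (Eventually.of_forall fun x => (ENNReal.ofReal_pos.2 (hρpos x)).ne')
  haveI : μρ.IsOpenPosMeasure := hac.isOpenPosMeasure
  -- integration against `μρ` is integration against `ρ dx`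
  have hint : ∀ g : (Fin 2 → EuclideanSpace ℝ (Fin 4)) → ℝ, ∫ x, g x ∂μρ = ∫ x, ρ x * g x := by
    intro g
    have h := integral_withDensity_eq_integral_smul (μ := volume) (f := fun x => (ρ x).toNNReal)
      (hρm.real_toNNReal) g
    have h' : (fun x => ((ρ x).toNNReal : ℝ≥0∞)) = fun x => ENNReal.ofReal (ρ x) := rfl
    rw [h'] at h
    rw [hμρ, h]
    refine integral_congr_ae (Eventually.of_forall fun x => ?_)
    simp only [NNReal.smul_def, smul_eq_mul, Real.coe_toNNReal _ (hρpos x).le]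
  -- the cutoff
  let bδ : ContDiffBump (0 : EuclideanSpace ℝ (Fin 4)) := ⟨δ, 2 * δ, hδ, by linarith⟩
  set η : (Fin 2 → EuclideanSpace ℝ (Fin 4)) → ℝ := fun x => 1 - bδ (x 0 - x 1) with hη
  have hηs : ContDiff ℝ ∞ η := contDiff_const.sub (bδ.contDiff.comp
    ((contDiff_apply ℝ (EuclideanSpace ℝ (Fin 4)) 0).sub (contDiff_apply ℝ (EuclideanSpace ℝ (Fin 4)) 1)))
  have hη01 : ∀ x, 0 ≤ η x ∧ η x ≤ 1 := fun x => ⟨sub_nonneg.2 bδ.le_one, by simp only [hη]; linarith [bδ.nonneg (x := x 0 - x 1)]⟩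
  have hη0 : ∀ x, η x ≠ 0 → δ < ‖x 0 - x 1‖ := by
    intro x hx
    by_contra hle
    push Not at hle
    apply hx
    simp only [hη, bδ.one_of_mem_closedBall (mem_closedBall_zero_iff.2 hle), sub_self]
  have hη1 : ∀ x, 2 * δ ≤ ‖x 0 - x 1‖ → η x = 1 := by
    intro x hx
    have : bδ (x 0 - x 1) = 0 := bδ.zero_of_le_dist (by simpa [dist_zero_right] using hx)
    simp only [hη, this, sub_zero]
  -- the real test function `η ρ g`, its complexification and its Schwartz incarnation
  have hTs : ∀ g : (Fin 2 → EuclideanSpace ℝ (Fin 4)) → ℝ, ContDiff ℝ ∞ g →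
      ContDiff ℝ ∞ fun x => ((η x * ρ x * g x : ℝ) : ℂ) := fun g hg =>
    Complex.ofRealCLM.contDiff.comp ((hηs.mul hρs).mul hg)
  have hTc : ∀ g : (Fin 2 → EuclideanSpace ℝ (Fin 4)) → ℝ, HasCompactSupport g →
      HasCompactSupport fun x => ((η x * ρ x * g x : ℝ) : ℂ) := fun g hg =>
    (hg.mul_left (f := fun x => η x * ρ x)).comp_left Complex.ofReal_zero
  have hTsupp : ∀ g : (Fin 2 → EuclideanSpace ℝ (Fin 4)) → ℝ,
      tsupport (fun x => ((η x * ρ x * g x : ℝ) : ℂ)) ⊆ Separated 2 δ := by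
    intro g x hx
    refine mem_separated_of_le ?_
    -- `tsupport ⊆ closure {δ < ‖x₀ − x₁‖} ⊆ {δ ≤ ‖x₀ − x₁‖}`
    have hcl : tsupport (fun x => ((η x * ρ x * g x : ℝ) : ℂ)) ⊆ {x | δ ≤ ‖x 0 - x 1‖} := by
      refine closure_minimal (fun y hy => ?_) (isClosed_le continuous_const (by fun_prop))
      have hηy : η y ≠ 0 := by
        intro h0; apply hy; simp [h0]
      exact (hη0 y hηy).le
    exact hcl hx
  -- the two real functionals
  let ℓ : Bool → ((Fin 2 → EuclideanSpace ℝ (Fin 4)) → ℝ) → ℝ := fun b g =>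
    if h : HasCompactSupport g ∧ ContDiff ℝ ∞ g then
      (fun z : ℂ => if b then z.re else z.im) (S₂ ((hTc g h.1).toSchwartzMap (hTs g h.2)))
    else 0
  have hℓ_eval : ∀ (b : Bool) (g : (Fin 2 → EuclideanSpace ℝ (Fin 4)) → ℝ) (hc : HasCompactSupport g) (hs : ContDiff ℝ ∞ g),
      ℓ b g = (fun z : ℂ => if b then z.re else z.im) (S₂ ((hTc g hc).toSchwartzMap (hTs g hs))) := by
    intro b g hc hs
    simp only [ℓ, dif_pos (And.intro hc hs)]
  -- additivity, homogeneity and the `L¹(μρ)` bound of both functionals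
  have hsm_add : ∀ (f g : (Fin 2 → EuclideanSpace ℝ (Fin 4)) → ℝ) (hf : HasCompactSupport f) (hfs : ContDiff ℝ ∞ f)
      (hg : HasCompactSupport g) (hgs : ContDiff ℝ ∞ g),
      (hTc (f + g) (hf.add hg)).toSchwartzMap (hTs (f + g) (hfs.add hgs)) =
        (hTc f hf).toSchwartzMap (hTs f hfs) + (hTc g hg).toSchwartzMap (hTs g hgs) := by
    intro f g hf hfs hg hgs
    ext x
    show ((η x * ρ x * (f + g) x : ℝ) : ℂ) = ((η x * ρ x * f x : ℝ) : ℂ) + ((η x * ρ x * g x : ℝ) : ℂ)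
    simp only [Pi.add_apply]
    push_cast
    ring
  have hsm_smul : ∀ (c : ℝ) (f : (Fin 2 → EuclideanSpace ℝ (Fin 4)) → ℝ) (hf : HasCompactSupport f) (hfs : ContDiff ℝ ∞ f),
      (hTc (c • f) (hf.smul_left (f := fun _ => c))).toSchwartzMap (hTs (c • f) (contDiff_const.smul hfs)) =
        (c : ℂ) • (hTc f hf).toSchwartzMap (hTs f hfs) := by
    intro c f hf hfs
    ext x
    show ((η x * ρ x * (c • f) x : ℝ) : ℂ) = (c : ℂ) • ((η x * ρ x * f x : ℝ) : ℂ)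
    simp only [Pi.smul_apply, smul_eq_mul]
    push_cast
    ring
  have hadd : ∀ b, ∀ f g : (Fin 2 → EuclideanSpace ℝ (Fin 4)) → ℝ, HasCompactSupport f → ContDiff ℝ ∞ f →
      HasCompactSupport g → ContDiff ℝ ∞ g → ℓ b (f + g) = ℓ b f + ℓ b g := by
    intro b f g hf hfs hg hgs
    rw [hℓ_eval b _ (hf.add hg) (hfs.add hgs), hℓ_eval b f hf hfs, hℓ_eval b g hg hgs, hsm_add f g hf hfs hg hgs, map_add]
    cases b <;> simp
  have hsmul : ∀ b, ∀ (c : ℝ) (f : (Fin 2 → EuclideanSpace ℝ (Fin 4)) → ℝ), HasCompactSupport f → ContDiff ℝ ∞ f →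
      ℓ b (c • f) = c * ℓ b f := by
    intro b c f hf hfs
    rw [hℓ_eval b (c • f) (hf.smul_left (f := fun _ => c)) (contDiff_const.smul hfs), hℓ_eval b f hf hfs, hsm_smul c f hf hfs,
      map_smul]
    cases b <;> simp
  have hbound : ∀ b, ∀ f : (Fin 2 → EuclideanSpace ℝ (Fin 4)) → ℝ, HasCompactSupport f → ContDiff ℝ ∞ f →
      |ℓ b f| ≤ B * ∫ x, |f x| ∂μρ := by
    intro b f hf hfs
    rw [hℓ_eval b f hf hfs, hint]
    set F := (hTc f hf).toSchwartzMap (hTs f hfs) with hF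
    have h1 : |(fun z : ℂ => if b then z.re else z.im) (S₂ F)| ≤ ‖S₂ F‖ := by
      cases b
      · exact Complex.abs_im_le_norm _
      · exact Complex.abs_re_le_norm _
    have h2 : ‖S₂ F‖ ≤ B * ∫ x, ‖F x‖ := hdens F (hTc f hf) (hTsupp f)
    have h3 : ∫ x, ‖F x‖ ≤ ∫ x, ρ x * |f x| := by
      refine integral_mono_of_nonneg (Eventually.of_forall fun x => norm_nonneg _) ?_ (Eventually.of_forall fun x => ?_)
      · exact (hρs.continuous.mul (continuous_abs.comp hfs.continuous)).integrable_of_hasCompactSupport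
          ((hf.norm).mul_left)
      · show ‖((η x * ρ x * f x : ℝ) : ℂ)‖ ≤ ρ x * |f x|
        rw [Complex.norm_real, Real.norm_eq_abs, abs_mul, abs_mul, abs_of_nonneg (hη01 x).1, abs_of_pos (hρpos x)]
        calc η x * ρ x * |f x| ≤ 1 * ρ x * |f x| := by gcongr; exact (hη01 x).2
          _ = ρ x * |f x| := by rw [one_mul]
    calc _ ≤ ‖S₂ F‖ := h1
      _ ≤ B * ∫ x, ‖F x‖ := h2
      _ ≤ B * ∫ x, ρ x * |f x| := by gcongr
  -- extend to `L¹(μρ)` and take the densities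
  have hcore : ∀ b, ∃ w : (Fin 2 → EuclideanSpace ℝ (Fin 4)) → ℝ, Measurable w ∧ (∀ x, |w x| ≤ B) ∧
      ∀ (f : (Fin 2 → EuclideanSpace ℝ (Fin 4)) → ℝ), HasCompactSupport f → ContDiff ℝ ∞ f →
        ℓ b f = ∫ x, w x * (ρ x * f x) := by
    intro b
    obtain ⟨Wb, hWb, hWbℓ⟩ := exists_extend_L1 μρ (ℓ b) (hadd b) (hsmul b) hB (hbound b)
    obtain ⟨g, hgi, hgb, hgW⟩ := exists_bounded_density_of_l1_bounded Wb B hWb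
    -- a measurable, everywhere bounded version of `g`
    set g' : (Fin 2 → EuclideanSpace ℝ (Fin 4)) → ℝ := fun x => max (-B) (min B (hgi.1.mk g x)) with hg'
    have hg'm : Measurable g' :=
      measurable_const.max (measurable_const.min hgi.1.stronglyMeasurable_mk.measurable)
    have hg'b : ∀ x, |g' x| ≤ B := fun x => by
      simp only [hg']
      exact abs_le.2 ⟨le_max_left _ _, max_le (by linarith) (min_le_left _ _)⟩
    have hg'ae : ∀ᵐ x ∂μρ, g' x = g x := by
      filter_upwards [hgi.1.ae_eq_mk, hgb] with x hx hxb
      simp only [hg', ← hx]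
      rw [min_eq_right (abs_le.1 hxb).2, max_eq_right (abs_le.1 hxb).1]
    refine ⟨g', hg'm, hg'b, fun f hf hfs => ?_⟩
    have hfi : Integrable f μρ := hfs.continuous.integrable_of_hasCompactSupport hf
    have hW := hWbℓ f hf hfs (hfi.toL1 f) (Integrable.coeFn_toL1 hfi)
    rw [← hW, hgW]
    have h1 : ∫ x, g x * (hfi.toL1 f) x ∂μρ = ∫ x, g' x * f x ∂μρ :=
      integral_congr_ae (by
        filter_upwards [Integrable.coeFn_toL1 hfi, hg'ae] with x hx hx'
        rw [hx, hx'])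
    rw [h1, hint]
    refine integral_congr_ae (Eventually.of_forall fun x => ?_)
    ring
  obtain ⟨wre, hwre_m, hwre_b, hwre⟩ := hcore true
  obtain ⟨wim, hwim_m, hwim_b, hwim⟩ := hcore false
  -- the complex density
  set W : (Fin 2 → EuclideanSpace ℝ (Fin 4)) → ℂ := fun x => (wre x : ℂ) + (wim x : ℂ) * Complex.I with hW
  have hWm : Measurable W :=
    (Complex.measurable_ofReal.comp hwre_m).add ((Complex.measurable_ofReal.comp hwim_m).mul_const _)
  have hWb : ∀ x, ‖W x‖ ≤ 2 * B := fun x => by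
    calc ‖W x‖ ≤ ‖(wre x : ℂ)‖ + ‖(wim x : ℂ) * Complex.I‖ := norm_add_le _ _
      _ = |wre x| + |wim x| := by simp
      _ ≤ B + B := add_le_add (hwre_b x) (hwim_b x)
      _ = 2 * B := by ring
  refine ⟨W, hWm, hWb, fun F hFc hFsupp => ?_⟩
  -- integrability of `W F`
  have hFi : Integrable (fun x => F x) := F.continuous.integrable_of_hasCompactSupport hFc
  have hWFi : Integrable (fun x => W x * F x) :=
    hFi.bdd_mul hWm.aestronglyMeasurable (Eventually.of_forall hWb)
  refine ⟨hWFi, ?_⟩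
  -- the separation of `F`'s support forces `η = 1` there
  have hsep : ∀ x, F x ≠ 0 → η x = 1 := fun x hx =>
    hη1 x (le_norm_sub_of_mem_separated (hFsupp (subset_tsupport _ hx)))
  -- ONE REAL COMPONENT: for a real-linear `L : ℂ → ℝ` (re or im) the real part-function `p = L ∘ F`
  have hcomp : ∀ (p : (Fin 2 → EuclideanSpace ℝ (Fin 4)) → ℝ), ContDiff ℝ ∞ p → HasCompactSupport p →
      (∀ x, p x ≠ 0 → F x ≠ 0) →
      ∀ (P : 𝓢((Fin 2 → EuclideanSpace ℝ (Fin 4)), ℂ)), (∀ x, P x = (p x : ℂ)) →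
        S₂ P = ∫ x, W x * (p x : ℂ) := by
    intro p hps hpc hpF P hP
    -- the quotient `q = p / ρ`
    set q : (Fin 2 → EuclideanSpace ℝ (Fin 4)) → ℝ := fun x => p x * (ρ x)⁻¹ with hq
    have hqs : ContDiff ℝ ∞ q := hps.mul (hρs.inv fun x => (hρpos x).ne')
    have hqc : HasCompactSupport q := hpc.mul_right
    have hpt : ∀ x, η x * ρ x * q x = p x := by
      intro x
      by_cases hx : p x = 0
      · simp [hq, hx]
      · rw [hsep x (hpF x hx), one_mul, hq]
        field_simp [(hρpos x).ne']
    have hsmP : (hTc q hqc).toSchwartzMap (hTs q hqs) = P := by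
      ext x
      show ((η x * ρ x * q x : ℝ) : ℂ) = P x
      rw [hpt x, hP x]
    -- both components of `S₂ P` through the densities
    have hre : (S₂ P).re = ∫ x, wre x * p x := by
      have h := hwre q hqc hqs
      rw [hℓ_eval true q hqc hqs, hsmP] at h
      simp only [if_true] at h
      rw [h]
      refine integral_congr_ae (Eventually.of_forall fun x => ?_)
      show wre x * (ρ x * q x) = wre x * p x
      simp only [hq]
      field_simp [(hρpos x).ne']
    have him : (S₂ P).im = ∫ x, wim x * p x := by
      have h := hwim q hqc hqs
      rw [hℓ_eval false q hqc hqs, hsmP] at h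
      simp only [Bool.false_eq_true, if_false] at h
      rw [h]
      refine integral_congr_ae (Eventually.of_forall fun x => ?_)
      show wim x * (ρ x * q x) = wim x * p x
      simp only [hq]
      field_simp [(hρpos x).ne']
    -- reassemble
    have hpi : Integrable p := hps.continuous.integrable_of_hasCompactSupport hpc
    have hi1 : Integrable fun x => ((wre x * p x : ℝ) : ℂ) :=
      (hpi.bdd_mul hwre_m.aestronglyMeasurable (Eventually.of_forall fun x => by
        rw [Real.norm_eq_abs]; exact hwre_b x)).ofReal
    have hi2 : Integrable fun x => ((wim x * p x : ℝ) : ℂ) * Complex.I :=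
      ((hpi.bdd_mul hwim_m.aestronglyMeasurable (Eventually.of_forall fun x => by
        rw [Real.norm_eq_abs]; exact hwim_b x)).ofReal).mul_const _
    calc S₂ P = ((S₂ P).re : ℂ) + ((S₂ P).im : ℂ) * Complex.I := (Complex.re_add_im _).symm
      _ = ((∫ x, wre x * p x : ℝ) : ℂ) + ((∫ x, wim x * p x : ℝ) : ℂ) * Complex.I := by rw [hre, him]
      _ = (∫ x, ((wre x * p x : ℝ) : ℂ)) + (∫ x, ((wim x * p x : ℝ) : ℂ) * Complex.I) := by
          rw [integral_mul_const, integral_complex_ofReal, integral_complex_ofReal]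
      _ = ∫ x, (((wre x * p x : ℝ) : ℂ) + ((wim x * p x : ℝ) : ℂ) * Complex.I) := (integral_add hi1 hi2).symm
      _ = ∫ x, W x * (p x : ℂ) := integral_congr_ae (Eventually.of_forall fun x => by
          simp only [hW]; push_cast; ring)
  -- the two parts of `F`
  have hFs : ContDiff ℝ ∞ (F : (Fin 2 → EuclideanSpace ℝ (Fin 4)) → ℂ) := F.smooth ⊤
  set pre : (Fin 2 → EuclideanSpace ℝ (Fin 4)) → ℝ := fun x => (F x).re with hpre
  set pim : (Fin 2 → EuclideanSpace ℝ (Fin 4)) → ℝ := fun x => (F x).im with hpim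
  have hpre_s : ContDiff ℝ ∞ pre := Complex.reCLM.contDiff.comp hFs
  have hpim_s : ContDiff ℝ ∞ pim := Complex.imCLM.contDiff.comp hFs
  have hpre_c : HasCompactSupport pre := hFc.comp_left Complex.zero_re
  have hpim_c : HasCompactSupport pim := hFc.comp_left Complex.zero_im
  have hpre_F : ∀ x, pre x ≠ 0 → F x ≠ 0 := fun x hx h0 => hx (by simp [hpre, h0])
  have hpim_F : ∀ x, pim x ≠ 0 → F x ≠ 0 := fun x hx h0 => hx (by simp [hpim, h0])
  set Pre : 𝓢((Fin 2 → EuclideanSpace ℝ (Fin 4)), ℂ) :=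
    (hpre_c.comp_left Complex.ofReal_zero).toSchwartzMap (Complex.ofRealCLM.contDiff.comp hpre_s) with hPre
  set Pim : 𝓢((Fin 2 → EuclideanSpace ℝ (Fin 4)), ℂ) :=
    (hpim_c.comp_left Complex.ofReal_zero).toSchwartzMap (Complex.ofRealCLM.contDiff.comp hpim_s) with hPim
  have hSre : S₂ Pre = ∫ x, W x * (pre x : ℂ) := hcomp pre hpre_s hpre_c hpre_F Pre fun x => rfl
  have hSim : S₂ Pim = ∫ x, W x * (pim x : ℂ) := hcomp pim hpim_s hpim_c hpim_F Pim fun x => rfl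
  have hFsplit : F = Pre + Complex.I • Pim := by
    ext x
    show F x = (pre x : ℂ) + Complex.I • (pim x : ℂ)
    rw [smul_eq_mul, mul_comm, hpre, hpim, Complex.re_add_im]
  -- integrability of the two parts against `W`
  have hWi : ∀ (p : (Fin 2 → EuclideanSpace ℝ (Fin 4)) → ℝ), ContDiff ℝ ∞ p → HasCompactSupport p →
      Integrable fun x => W x * (p x : ℂ) := fun p hps hpc =>
    ((hps.continuous.integrable_of_hasCompactSupport hpc).ofReal).bdd_mul hWm.aestronglyMeasurable
      (Eventually.of_forall hWb)
  calc S₂ F = S₂ Pre + Complex.I * S₂ Pim := by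
        rw [hFsplit, map_add, map_smul, smul_eq_mul]
    _ = (∫ x, W x * (pre x : ℂ)) + Complex.I * ∫ x, W x * (pim x : ℂ) := by rw [hSre, hSim]
    _ = (∫ x, W x * (pre x : ℂ)) + ∫ x, Complex.I * (W x * (pim x : ℂ)) := by rw [integral_const_mul]
    _ = ∫ x, (W x * (pre x : ℂ) + Complex.I * (W x * (pim x : ℂ))) :=
        (integral_add (hWi pre hpre_s hpre_c) ((hWi pim hpim_s hpim_c).const_mul _)).symm
    _ = ∫ x, W x * F x := integral_congr_ae (Eventually.of_forall fun x => by
        show W x * (pre x : ℂ) + Complex.I * (W x * (pim x : ℂ)) = W x * F x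
        conv_rhs => rw [← Complex.re_add_im (F x)]
        simp only [hpre, hpim]
        ring)

end Summit.QuantumFields.YangMills.Theorems.F4SubCurvatureDoorSubCurvatureKernelDensity

end
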